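import Mathlib
import Summits.Ventures.PercRepro2.Defs
import Summits.Ventures.PercRepro2.Harris
import Summits.Ventures.PercRepro2.CoinDefs
import Summits.Ventures.PercRepro2.CoinStarDefs
import Summits.Ventures.PercRepro2.CoinLsmCoreDefs
import Summits.Ventures.PercRepro2.CoinLsmCoreU
import Summits.Ventures.PercRepro2.CoinCoreGate
import Summits.Ventures.PercRepro2.CoinOrTailKDefs
import Summits.Ventures.PercRepro2.CoinOrTailKSums
import Summits.Ventures.PercRepro2.CoinOrTailLsmCore
import Summits.Ventures.PercRepro2.CoinTreeCore
import Summits.Ventures.PercRepro2.CoinKSureCore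
import Summits.Ventures.PercRepro2.CoinKSureTailSums
import Summits.Ventures.PercRepro2.CoinKSureGen

import Summits.Ventures.PercRepro2.CoinKSureCloseStar
import Summits.Ventures.PercRepro2.CoinKSureTwoLevel
import Summits.Ventures.PercRepro2.CoinKSureMarkerB
/-!
# Row 2′DARC at an OR-tail with BOTH markers at the second sure OR-vertex of the head
(blind cell PercRepro2, night-2 g16; proofs/NIGHT2-DARC.md §55.3, the entry `(b, b)`)

The missing entry of the marker table of §55.3: markers `(b, b)` — the VARIANCE form of the
row at the second OR-vertex `b` (entered only from `entb ⊆ U` by sure coins, any out-arcs into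
the head).  `X = Y = 1[b ∈ S⁺] = entInd entb` after the two level reductions, and since
`X·Y = X` the seven sums collapse to four; `orTailKSure_functional_nonneg_markers` with
`x = y = entInd entb` closes exactly as in `darc_of_orTailKSure_markerB`.
-/

namespace Summit.Ventures.PercRepro2.Coin

open Classical

section MarkerBB

variable {V : Type*} {E : Type*} [Fintype V] [DecidableEq V] [Fintype E] [DecidableEq E]
  {R : Type*} [Field R] [LinearOrder R] [IsStrictOrderedRing R]
  {arcs : E → Finset (V × V)} {s : V} {U : Finset V} {ent : Finset V} {c : V → E} {a w : V}
  {entb : Finset V} {d : V → E} {b : V}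

/-- **THEOREM (row 2′DARC at an OR-tail, BOTH markers at a second sure OR-vertex of the head).**
`OrTailK arcs s U ent c a` with sure entry coins, a second OR-vertex `b` entered only from
`entb ⊆ U` by sure coins (`a ∉ entb`), `SameEnds`, the cluster law of `U` log-supermodular,
every head, every probability vector: `DARC pr arcs s {t} b b a w`. -/
theorem darc_of_orTailKSure_markerBB (pr : E → R) (hp : IsProbVec pr) (hS : SameEnds arcs)
    (h : OrTailK arcs s U ent c a) (hb : OrTailK arcs s (insert a U) entb d b) (hae : a ∉ entb)
    (hsure : ∀ r ∈ ent, pr (c r) = 1) (hsureb : ∀ r ∈ entb, pr (d r) = 1)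
    (hν : ∀ W W', W ⊆ U → W' ⊆ U →
      prob pr (coreLevel arcs s U W) * prob pr (coreLevel arcs s U W') ≤
        prob pr (coreLevel arcs s U (W ∩ W')) * prob pr (coreLevel arcs s U (W ∪ W')))
    {t : V} (htC : t ∉ insert b (insert a U)) (hts : t ≠ s) (hws : w ≠ s)
    (hwC : w ∉ insert b (insert a U)) :
    DARC pr arcs s {t} b b a w := by
  have hC := hb.closedInCoreU
  have hba : b ≠ a := fun e => hb.a_notin (e ▸ Finset.mem_insert_self a U)
  have hbU : b ∉ U := fun hbU => hb.a_notin (Finset.mem_insert_of_mem hbU)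
  have hbC : b ∈ insert b (insert a U) := Finset.mem_insert_self _ _
  have haC : a ∈ insert b (insert a U) := Finset.mem_insert_of_mem (Finset.mem_insert_self _ _)
  have hwe : w ∉ entb := fun hw => hwC (Finset.mem_insert_of_mem (hb.ent_sub hw))
  have hbw : b ≠ w := fun e => hwC (e ▸ hbC)
  unfold DARC
  rw [hC.phiC_gate_eq pr hS htC hts hbC hbC haC hws hwC]
  set A : Finset V → R := fun X => prob pr (coreAvoidEvent arcs s t (insert b (insert a U)) X)
    with hAdef
  have hm1b : ∀ W : Finset V, (fun _ : Finset V => (1 : R)) (insert b W) = (fun _ => (1 : R)) W :=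
    fun _ => rfl
  have hm1a : ∀ W : Finset V, (fun _ : Finset V => (1 : R)) (insert a W) = (fun _ => (1 : R)) W :=
    fun _ => rfl
  have hgb0 : ∀ W : Finset V, b ∉ W → (fun W : Finset V => if b ∈ W then (1 : R) else 0) W = 0 := by
    intro W hbW; simp only [hbW, if_false]
  have hgb1 : ∀ W : Finset V, b ∉ W →
      (fun W : Finset V => if b ∈ W then (1 : R) else 0) (insert b W) = (fun _ => (1 : R)) W := by
    intro W _; simp only [Finset.mem_insert_self, if_true]
  have hgq0 : ∀ W : Finset V, b ∉ W →
      (fun W : Finset V => (if b ∈ W then (1 : R) else 0) * (if b ∈ W then (1 : R) else 0)) W = 0 := by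
    intro W hbW; simp only [hbW, if_false, mul_zero]
  have hgq1 : ∀ W : Finset V, b ∉ W →
      (fun W : Finset V => (if b ∈ W then (1 : R) else 0) * (if b ∈ W then (1 : R) else 0))
          (insert b W) = (fun _ => (1 : R)) W := by
    intro W _; simp only [Finset.mem_insert_self, if_true, mul_one]
  -- the sums after the two level reductions (`x = y`, so four distinct sums)
  have eΛ := two_level_R h hb pr hsureb A (fun _ => (1 : R)) hm1b hm1a
  have eΛb := two_level_R_tail h hb hae pr hsureb A (fun W => if b ∈ W then (1 : R) else 0)
    (fun _ => (1 : R)) hgb0 hgb1 hm1a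
  have eM := two_level_G h hb hae hwe hba pr hsureb A (fun _ => (1 : R)) hm1b hm1a
  have eMb := two_level_G_tail h hb hae hwe hba pr hsureb A
    (fun W => if b ∈ W then (1 : R) else 0) (fun _ => (1 : R)) hgb0 hgb1 hm1a
  have eMbb := two_level_G_tail h hb hae hwe hba pr hsureb A
    (fun W => (if b ∈ W then (1 : R) else 0) * (if b ∈ W then (1 : R) else 0))
    (fun _ => (1 : R)) hgq0 hgq1 hm1a
  simp only [mul_one] at eΛ eΛb eM eMb eMbb
  rw [eΛ, eΛb, eM, eMb, eMbb]
  have hbW : ∀ W ∈ U.powerset, b ∉ W := fun W hW hbW => hbU (Finset.mem_powerset.1 hW hbW)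
  have c1 : ∑ x ∈ U.powerset, prob pr (coreLevel arcs s U x) * rValK (closeB entb b A) pr ent c a x =
      ∑ x ∈ U.powerset, prob pr (coreLevel arcs s U x) * rValK (closeBE entb b A) pr ent c a x :=
    Finset.sum_congr rfl fun W hW => by rw [rValK_closeBE A pr (hbW W hW) hba]
  have c3 : ∑ x ∈ U.powerset, prob pr (coreLevel arcs s U x) * rValK (closeB entb b A) pr ent c a x *
      entInd entb x =
      ∑ x ∈ U.powerset, prob pr (coreLevel arcs s U x) * rValK (closeBE entb b A) pr ent c a x *
        entInd entb x :=
    Finset.sum_congr rfl fun W hW => by rw [rValK_closeBE A pr (hbW W hW) hba]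
  have c4 : ∑ x ∈ U.powerset, prob pr (coreLevel arcs s U x) * gValK (closeB entb b A) pr ent c a w x =
      ∑ x ∈ U.powerset, prob pr (coreLevel arcs s U x) * gValK (closeBE entb b A) pr ent c a w x :=
    Finset.sum_congr rfl fun W hW => by rw [gValK_closeBE A pr (hbW W hW) hba hbw]
  have c6 : ∑ x ∈ U.powerset, prob pr (coreLevel arcs s U x) * gValK (closeB entb b A) pr ent c a w x *
      entInd entb x =
      ∑ x ∈ U.powerset, prob pr (coreLevel arcs s U x) * gValK (closeBE entb b A) pr ent c a w x *
        entInd entb x :=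
    Finset.sum_congr rfl fun W hW => by rw [gValK_closeBE A pr (hbW W hW) hba hbw]
  obtain ⟨hA0, hAmono, hAlsm⟩ := OrTailU.head_props (U := insert a U) (a := b) pr hp hS t
  have key := orTailKSure_functional_nonneg_markers U (fun W => prob pr (coreLevel arcs s U W))
    (closeBE entb b A) pr ent c a w (fun W => entInd entb W) (fun W => entInd entb W)
    hp.nonneg hp.le_one hsure (fun W => prob_nonneg hp _)
    (fun s' hs' t' ht' => hν s' t' hs' ht') (closeBE_nonneg entb b A hA0)
    (closeBE_lsm entb b A hA0 hAlsm hAmono) (closeBE_mono entb b A hAmono)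
    (fun W => entInd_nonneg entb W) (fun W => entInd_nonneg entb W)
    (fun s t => entInd_mono entb s t) (fun s t => entInd_mono entb s t)
  simp only [entInd_mul_self] at key
  rw [c1, c3, c4, c6]
  exact key

end MarkerBB

end Summit.Ventures.PercRepro2.Coin
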